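import Mathlib
import Summits.KontsevichZagierPeriods.Zeta5Search.BigPrimeDivisibility
import HarnessLib

/-!
# ζ(5) search — the window of (W∞) is EXACTLY the Bailey excess: `p = d(b) + 2 ⟹ p ∤ W(b)`

Cell `pub-zeta5` (HONEST FRAMING: systematic search; no irrationality claim unless certified), typer seat
generation 7.  SHARPNESS of the big-prime divisibility theorem (`BigPrimeDivisibility.lean`): gen-2 g5 OBSERVED
(REPORT-gen2-g5 §5e, "holds at p = d+1 in 457/457, FAILS at p = d+2 in 139/139") that the ζ(3)-coefficient `W(b)` is
never divisible by the prime just beyond the excess.  THEOREM (`padicValRat_coeffW_excess_add_two`): for `b` in the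
polytope and a prime `p = d(b) + 2` with `p ≥ max(5, b₀+1)`, `W(b) ≠ 0` and `v_p(W(b)) = 0`; likewise
(`padicValRat_coeffU_half_excess_add_one`) `v_p(U(b)) = 0` for `2p = d(b) + 2`.  PROOF: in the notation of
`BigPrimeDual`/`BigPrimeDivisibility`, `deg M_b = 7p − 6b₀ − 5 + 2Σb_j` EXACTLY with leading coefficient `2`
(`natDegree_MF`, `leadingCoeff_MF`), and `p = d+2` makes this `5p − 1`, the first degree at which the power sum
`Σ_{x∈𝔽_p} [X^4] M(X+x)` is non-zero: it equals `−lc(M)` (`sum_taylor_coeff_top`: `Σ_x x^{5(p−1)} = −1` and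
`C(5p−1, 4) ≡ 1`), so `Z ≡ 2U ≢ 0 (mod p)`.  OUR theorem; a statement about a coefficient, not about irrationality.
-/

noncomputable section

open Finset Polynomial

namespace Summit.KontsevichZagierPeriods.Zeta5Search.BigPrime

open Summit.KontsevichZagierPeriods.Zeta5Search.DualSeries (InBox)
open Summit.KontsevichZagierPeriods.Zeta5Search.WedgeDictionary (IsPFData coeffU coeffW coeffU_eq coeffW_eq
  exists_isPFData dOf)
open Summit.KontsevichZagierPeriods.Zeta5Search.ExcessWindow (sum_pow_zmod_eq sum_eval_iterate_derivative_X_pow)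

/-! ### The power sum at the critical degree -/

section ModP

variable {p : ℕ} [hp : Fact p.Prime]

/-- The falling factorial at the critical exponent: `((r+1)p − 1)(…)((r+1)p − r) ≡ (−1)^r r! (mod p)`. -/
theorem descFactorial_top_cast (r : ℕ) (hr : r < p) :
    ((((r + 1) * p - 1).descFactorial r : ℕ) : ZMod p) = (-1) ^ r * (r.factorial : ZMod p) := by
  rw [Nat.descFactorial_eq_prod_range, Nat.cast_prod]
  have h : ∀ i ∈ range r, ((((r + 1) * p - 1 - i : ℕ) : ZMod p)) = -((i + 1 : ℕ) : ZMod p) := by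
    intro i hi
    have hi' := mem_range.1 hi
    have hle : i + 1 ≤ (r + 1) * p := by nlinarith [hp.out.two_le]
    have : ((r + 1) * p - 1 - i : ℕ) + (i + 1) = (r + 1) * p := by omega
    have hc : (((r + 1) * p - 1 - i : ℕ) : ZMod p) + ((i + 1 : ℕ) : ZMod p) = 0 := by
      rw [← Nat.cast_add, this, Nat.cast_mul, ZMod.natCast_self, mul_zero]
    exact eq_neg_of_add_eq_zero_left hc
  rw [prod_congr rfl h, prod_neg, card_range, ← Nat.cast_prod, ← Finset.prod_range_add_one_eq_factorial]

/-- At the critical degree `m = (r+1)p − 1` the power sum of the `r`-th derivative of `X^m` is `−(−1)^r·r!`. -/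
theorem sum_eval_iterate_derivative_X_pow_top (r : ℕ) (hr : r < p) :
    ∑ x : ZMod p, ((derivative^[r]) ((X : (ZMod p)[X]) ^ ((r + 1) * p - 1))).eval x =
      -((-1) ^ r * (r.factorial : ZMod p)) := by
  classical
  have hp1 : 1 ≤ p := hp.out.one_le
  rw [Polynomial.iterate_derivative_X_pow_eq_natCast_mul]
  simp only [eval_mul, eval_natCast, eval_pow, eval_X, ← Finset.mul_sum]
  have he : (r + 1) * p - 1 - r = (p - 1) * (r + 1) := by
    obtain ⟨k, hk⟩ : ∃ k, p = k + 1 := ⟨p - 1, by omega⟩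
    rw [hk, Nat.add_sub_cancel]
    have : (r + 1) * (k + 1) = k * (r + 1) + r + 1 := by ring
    omega
  have hne : (r + 1) * p - 1 - r ≠ 0 := by rw [he]; exact Nat.mul_ne_zero (by have := hp.out.two_le; omega) (by omega)
  rw [sum_pow_zmod_eq p _ hne, if_pos (by rw [he]; exact dvd_mul_right _ _), descFactorial_top_cast r hr]
  ring

/-- **Power sum at the critical degree.**  For `M ∈ 𝔽_p[X]` of degree EXACTLY `r + (r+1)(p−1)` (`r < p`):
`Σ_{x∈𝔽_p} [X^r] M(X + x) = −(−1)^r · lc(M)`. -/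
theorem sum_taylor_coeff_top (M : (ZMod p)[X]) (r : ℕ) (hr : r < p)
    (hM : M.natDegree = r + (r + 1) * (p - 1)) :
    ∑ x : ZMod p, (taylor x M).coeff r = -((-1) ^ r * M.leadingCoeff) := by
  classical
  have hp1 : 1 ≤ p := hp.out.one_le
  have htop : r + (r + 1) * (p - 1) = (r + 1) * p - 1 := by
    obtain ⟨k, hk⟩ : ∃ k, p = k + 1 := ⟨p - 1, by omega⟩
    rw [hk, Nat.add_sub_cancel]
    have : (r + 1) * (k + 1) = (r + 1) * k + r + 1 := by ring
    omega
  -- derivative form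
  have hfac : ∀ x : ZMod p,
      ((derivative^[r]) M).eval x = (r.factorial : ZMod p) * (taylor x M).coeff r := by
    intro x
    rw [taylor_coeff, ← factorial_smul_hasseDeriv, LinearMap.smul_apply, eval_smul, nsmul_eq_mul]
  have hunit : (r.factorial : ZMod p) ≠ 0 := by
    rw [Ne, ZMod.natCast_eq_zero_iff, hp.out.dvd_factorial]; omega
  have hsum : ∑ x : ZMod p, ((derivative^[r]) M).eval x = -((-1) ^ r * (r.factorial : ZMod p)) * M.leadingCoeff := by
    have hrepr : (derivative^[r]) M =
        ∑ i ∈ range (M.natDegree + 1), C (M.coeff i) * (derivative^[r]) ((X : (ZMod p)[X]) ^ i) := by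
      conv_lhs => rw [M.as_sum_range_C_mul_X_pow]
      rw [iterate_derivative_sum]
      refine Finset.sum_congr rfl fun i _ => ?_
      rw [iterate_derivative_C_mul]
    rw [hrepr]
    simp only [eval_finsetSum, eval_mul, eval_C]
    rw [Finset.sum_comm, sum_range_succ, Finset.sum_eq_zero, zero_add]
    · rw [← Finset.mul_sum, hM, htop, sum_eval_iterate_derivative_X_pow_top r hr, leadingCoeff, hM, htop]
      ring
    · intro i hi
      have hi' : i < r + (r + 1) * (p - 1) := by rw [← hM]; exact mem_range.1 hi
      rw [← Finset.mul_sum, sum_eval_iterate_derivative_X_pow p r i hi', mul_zero]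
  simp_rw [hfac] at hsum
  rw [← mul_sum] at hsum
  have : (r.factorial : ZMod p) * ∑ x : ZMod p, (taylor x M).coeff r =
      (r.factorial : ZMod p) * (-((-1) ^ r * M.leadingCoeff)) := by rw [hsum]; ring
  exact mul_left_cancel₀ hunit this

/-! ### Exact degree and leading coefficient of the dual polynomial -/

/-- `deg M_b + 6n + 5 = 7p + 2Σ_j β_j` exactly (`n < p`, `2β_j ≤ n`, `p ≥ 3`). -/
theorem natDegree_MF {n : ℕ} (hn : n < p) (hp3 : 3 ≤ p) (β : ℕ → ℕ) (hβ : ∀ j ∈ range 7, 2 * β j ≤ n) :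
    (MF p n β).natDegree + 6 * n + 5 = 7 * p + 2 * ∑ j ∈ range 7, β j := by
  have h2 : (2 : ZMod p) ≠ 0 := by
    change ((2 : ℕ) : ZMod p) ≠ 0
    rw [Ne, ZMod.natCast_eq_zero_iff]
    intro h; have := Nat.le_of_dvd (by norm_num) h; omega
  have hlin : (C (2 : ZMod p) * X + C (n : ZMod p)).natDegree = 1 := natDegree_linear h2
  have hpall_monic : (pall p n).Monic := monic_prod_of_monic _ _ fun s _ => monic_X_add_C _
  have hK_monic : ∀ j ∈ range 7, (KF p n (β j)).Monic := fun j _ => monic_prod_of_monic _ _ fun u _ => monic_X_add_C _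
  have hprod_monic : (∏ j ∈ range 7, KF p n (β j)).Monic := monic_prod_of_monic _ _ hK_monic
  have hpall : (pall p n).natDegree = n + 1 := by
    rw [pall, natDegree_prod_of_monic _ _ fun s _ => monic_X_add_C _]
    simp only [natDegree_X_add_C, sum_const, card_range, smul_eq_mul, mul_one]
  have hK : ∀ j ∈ range 7, (KF p n (β j)).natDegree + (n + 1) = p + 2 * β j := by
    intro j hj
    have hb := hβ j hj
    have hcard : #(blockF p n (β j)) = (n - β j) + 1 - β j := by
      rw [blockF, card_image_of_injOn ((cast_injOn_range hn).mono (by exact_mod_cast block_subset n (β j))),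
        block, Nat.card_Icc]
    have hdeg : (KF p n (β j)).natDegree = p - #(blockF p n (β j)) := by
      rw [KF, natDegree_prod_of_monic _ _ fun u _ => monic_X_add_C _]
      simp only [natDegree_X_add_C, sum_const, card_univ_sdiff, ZMod.card, smul_eq_mul, mul_one]
    rw [hdeg, hcard]
    have : #(blockF p n (β j)) ≤ p := by rw [hcard]; omega
    omega
  have hKsum : (∏ j ∈ range 7, KF p n (β j)).natDegree + 7 * (n + 1) = 7 * p + 2 * ∑ j ∈ range 7, β j := by
    rw [natDegree_prod_of_monic _ _ hK_monic]
    have := sum_congr rfl hK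
    rw [sum_add_distrib, sum_const, card_range, smul_eq_mul, sum_add_distrib, sum_const, card_range,
      smul_eq_mul, ← mul_sum] at this
    omega
  have hlin0 : (C (2 : ZMod p) * X + C (n : ZMod p)) ≠ 0 :=
    ne_zero_of_natDegree_gt (n := 0) (by rw [hlin]; norm_num)
  have hd1 : ((C (2 : ZMod p) * X + C (n : ZMod p)) * pall p n).natDegree = 1 + (n + 1) := by
    rw [natDegree_mul' (by rw [hpall_monic.leadingCoeff, mul_one, leadingCoeff_linear h2]; exact h2), hlin, hpall]
  have hne1 : (C (2 : ZMod p) * X + C (n : ZMod p)) * pall p n ≠ 0 := mul_ne_zero hlin0 hpall_monic.ne_zero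
  have hMF : (MF p n β).natDegree = 1 + (n + 1) + (∏ j ∈ range 7, KF p n (β j)).natDegree := by
    rw [MF, natDegree_mul' (by rw [hprod_monic.leadingCoeff, mul_one]; exact leadingCoeff_ne_zero.2 hne1), hd1]
  omega

/-- The leading coefficient of `M_b` is `2`. -/
theorem leadingCoeff_MF {n : ℕ} (hp3 : 3 ≤ p) (β : ℕ → ℕ) : (MF p n β).leadingCoeff = 2 := by
  have h2 : (2 : ZMod p) ≠ 0 := by
    change ((2 : ℕ) : ZMod p) ≠ 0
    rw [Ne, ZMod.natCast_eq_zero_iff]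
    intro h; have := Nat.le_of_dvd (by norm_num) h; omega
  have hpall_monic : (pall p n).Monic := monic_prod_of_monic _ _ fun s _ => monic_X_add_C _
  have hprod_monic : (∏ j ∈ range 7, KF p n (β j)).Monic :=
    monic_prod_of_monic _ _ fun j _ => monic_prod_of_monic _ _ fun u _ => monic_X_add_C _
  rw [MF, leadingCoeff_mul, leadingCoeff_mul, leadingCoeff_linear h2, hpall_monic.leadingCoeff,
    hprod_monic.leadingCoeff, mul_one, mul_one]

end ModP

/-! ### Sharpness -/

section Sharp

/-- Cleared form ⟹ exact valuation `0`: `U·w = Z` with `p ∤ U`, `p ∤ Z` ⟹ `w ≠ 0` and `v_p(w) = 0`. -/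
theorem padicValRat_eq_zero_of_eq {p : ℕ} [hp : Fact p.Prime] {U Z : ℤ} {w : ℚ} (hUw : (U : ℚ) * w = Z)
    (hU : ¬ (p : ℤ) ∣ U) (hZ : ¬ (p : ℤ) ∣ Z) : w ≠ 0 ∧ padicValRat p w = 0 := by
  have hU0 : U ≠ 0 := fun h => hU (by rw [h]; exact dvd_zero _)
  have hZ0 : Z ≠ 0 := fun h => hZ (by rw [h]; exact dvd_zero _)
  have hw : w = (Z : ℚ) / U := by rw [eq_div_iff (by exact_mod_cast hU0), mul_comm]; exact hUw
  refine ⟨by rw [hw]; exact div_ne_zero (by exact_mod_cast hZ0) (by exact_mod_cast hU0), ?_⟩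
  rw [hw, padicValRat.div (by exact_mod_cast hZ0) (by exact_mod_cast hU0), padicValRat.of_int, padicValRat.of_int,
    padicValInt.eq_zero_of_not_dvd hU, padicValInt.eq_zero_of_not_dvd hZ]
  simp

/-- **(W∞) is SHARP: the prime just beyond the Bailey excess does NOT divide the ζ(3)-coefficient.**  For `b` in
the Brown–Zudilin polytope and a prime `p = d(b) + 2` with `p ≥ max(5, b₀ + 1)`: `W(b) ≠ 0` and `v_p(W(b)) = 0`
(gen-2 g5 observed 139/139; here a theorem: `deg M_b = 5p − 1` and `Σ_{x∈𝔽_p}[X^4]M_b(X+x) = −2`). -/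
theorem padicValRat_coeffW_excess_add_two (b : ℕ → ℤ) (p : ℕ) (hb : InBox b)
    (h2 : ∀ i ∈ range 7, 2 * b (i + 1) ≤ b 0) (h3 : ∑ i ∈ range 7, b (i + 1) ≤ 3 * b 0)
    (hprime : p.Prime) (hp5 : 5 ≤ p) (hpb : b 0 + 1 ≤ (p : ℤ)) (hpd : (p : ℤ) = dOf b + 2) :
    coeffW b ≠ 0 ∧ padicValRat p (coeffW b) = 0 := by
  haveI : Fact p.Prime := ⟨hprime⟩
  obtain ⟨e0, hS, hβ, hS3⟩ := polytope_data b hb h2 h3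
  have hnp : (b 0).toNat < p := by omega
  have hpd' : p + ∑ j ∈ range 7, (b (j + 1)).toNat = 3 * (b 0).toNat + 2 := by
    have := hpd; rw [dOf, hS, e0] at this; omega
  have hhalf : ∀ j ∈ range 7, 2 * b (j + 1) ≤ b 0 + 1 := fun j hj => by have := h2 j hj; omega
  obtain ⟨c, hc⟩ := exists_isPFData b hb (by omega)
  have hUW := Uall_mul_sum_eq b hb hhalf hc (o := 2) (by norm_num)
  rw [← coeffW_eq hc] at hUW
  refine padicValRat_eq_zero_of_eq hUW (not_dvd_Uall hprime hnp) ?_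
  have hdeg : (MF p (b 0).toNat fun j => (b (j + 1)).toNat).natDegree = 4 + (4 + 1) * (p - 1) := by
    have := natDegree_MF (p := p) hnp (by omega) (fun j => (b (j + 1)).toNat) hβ
    beta_reduce at this
    omega
  rw [← ZMod.intCast_zmod_eq_zero_iff_dvd, Zsum_cast hp5 hnp _ (by norm_num : 3 < 4),
    sum_taylor_coeff_top _ 4 (by omega) hdeg, leadingCoeff_MF (by omega)]
  have hU : ((Uall (b 0).toNat : ℤ) : ZMod p) ≠ 0 := by
    rw [Ne, ZMod.intCast_zmod_eq_zero_iff_dvd]; exact not_dvd_Uall hprime hnp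
  have htwo : (2 : ZMod p) ≠ 0 := by
    change ((2 : ℕ) : ZMod p) ≠ 0
    rw [Ne, ZMod.natCast_eq_zero_iff]
    intro h; have := Nat.le_of_dvd (by norm_num) h; omega
  intro h
  refine mul_ne_zero htwo hU ?_
  linear_combination h

/-- **(U∞) is SHARP**: for a prime `p` with `2p = d(b) + 2` and `p ≥ max(5, b₀ + 1)`, `U(b) ≠ 0` and `v_p(U(b)) = 0`. -/
theorem padicValRat_coeffU_half_excess_add_one (b : ℕ → ℤ) (p : ℕ) (hb : InBox b)
    (h2 : ∀ i ∈ range 7, 2 * b (i + 1) ≤ b 0) (h3 : ∑ i ∈ range 7, b (i + 1) ≤ 3 * b 0)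
    (hprime : p.Prime) (hp5 : 5 ≤ p) (hpb : b 0 + 1 ≤ (p : ℤ)) (hpd : 2 * (p : ℤ) = dOf b + 2) :
    coeffU b ≠ 0 ∧ padicValRat p (coeffU b) = 0 := by
  haveI : Fact p.Prime := ⟨hprime⟩
  obtain ⟨e0, hS, hβ, hS3⟩ := polytope_data b hb h2 h3
  have hnp : (b 0).toNat < p := by omega
  have hpd' : 2 * p + ∑ j ∈ range 7, (b (j + 1)).toNat = 3 * (b 0).toNat + 2 := by
    have := hpd; rw [dOf, hS, e0] at this; omega
  have hhalf : ∀ j ∈ range 7, 2 * b (j + 1) ≤ b 0 + 1 := fun j hj => by have := h2 j hj; omega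
  obtain ⟨c, hc⟩ := exists_isPFData b hb (by omega)
  have hUW := Uall_mul_sum_eq b hb hhalf hc (o := 4) (by norm_num)
  rw [← coeffU_eq hc] at hUW
  refine padicValRat_eq_zero_of_eq hUW (not_dvd_Uall hprime hnp) ?_
  have hdeg : (MF p (b 0).toNat fun j => (b (j + 1)).toNat).natDegree = 2 + (2 + 1) * (p - 1) := by
    have := natDegree_MF (p := p) hnp (by omega) (fun j => (b (j + 1)).toNat) hβ
    beta_reduce at this
    omega
  rw [← ZMod.intCast_zmod_eq_zero_iff_dvd, Zsum_cast hp5 hnp _ (by norm_num : 1 < 4),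
    sum_taylor_coeff_top _ 2 (by omega) hdeg, leadingCoeff_MF (by omega)]
  have hU : ((Uall (b 0).toNat : ℤ) : ZMod p) ≠ 0 := by
    rw [Ne, ZMod.intCast_zmod_eq_zero_iff_dvd]; exact not_dvd_Uall hprime hnp
  have htwo : (2 : ZMod p) ≠ 0 := by
    change ((2 : ℕ) : ZMod p) ≠ 0
    rw [Ne, ZMod.natCast_eq_zero_iff]
    intro h; have := Nat.le_of_dvd (by norm_num) h; omega
  intro h
  refine mul_ne_zero htwo hU ?_
  linear_combination h

end Sharp


end Summit.KontsevichZagierPeriods.Zeta5Search.BigPrime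

end
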